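import Literature.NumberTheory.LFunctions.WeilTwoPrimePos59Def
import Literature.NumberTheory.LFunctions.WeilTwoPrimePos59DataPme6
import Literature.NumberTheory.LFunctions.WeilBlockRowsPZ
import HarnessLib

/-!
# Two-prime positivity certificate (a₀ = 59/100): dominance of `R = S'(κ) − UᵀU`, block 0, rows 20–24

Kernel facts by `decide +kernel`, one declaration per row. Pure proof file.
-/

noncomputable section

namespace Literature.NumberTheory.LFunctions

set_option maxHeartbeats 0 in
/-- dominance of `R = S'(κ) − UᵀU`, block 0, row 20 (positivity certificate). [folklore] -/
theorem checkDomRowPZ0_20_weilCert23P : weilCert23PBase.checkDomRowPZ weilCert23PPme weilCert23PDne weilCert23PLse weilCert23PHpe weilCert23EKappaLit 0 20 = true := by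
  decide +kernel

set_option maxHeartbeats 0 in
/-- dominance of `R = S'(κ) − UᵀU`, block 0, row 21 (positivity certificate). [folklore] -/
theorem checkDomRowPZ0_21_weilCert23P : weilCert23PBase.checkDomRowPZ weilCert23PPme weilCert23PDne weilCert23PLse weilCert23PHpe weilCert23EKappaLit 0 21 = true := by
  decide +kernel

set_option maxHeartbeats 0 in
/-- dominance of `R = S'(κ) − UᵀU`, block 0, row 22 (positivity certificate). [folklore] -/
theorem checkDomRowPZ0_22_weilCert23P : weilCert23PBase.checkDomRowPZ weilCert23PPme weilCert23PDne weilCert23PLse weilCert23PHpe weilCert23EKappaLit 0 22 = true := by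
  decide +kernel

set_option maxHeartbeats 0 in
/-- dominance of `R = S'(κ) − UᵀU`, block 0, row 23 (positivity certificate). [folklore] -/
theorem checkDomRowPZ0_23_weilCert23P : weilCert23PBase.checkDomRowPZ weilCert23PPme weilCert23PDne weilCert23PLse weilCert23PHpe weilCert23EKappaLit 0 23 = true := by
  decide +kernel

set_option maxHeartbeats 0 in
/-- dominance of `R = S'(κ) − UᵀU`, block 0, row 24 (positivity certificate). [folklore] -/
theorem checkDomRowPZ0_24_weilCert23P : weilCert23PBase.checkDomRowPZ weilCert23PPme weilCert23PDne weilCert23PLse weilCert23PHpe weilCert23EKappaLit 0 24 = true := by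
  decide +kernel


end Literature.NumberTheory.LFunctions
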